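import Literature.NumberTheory.GaloisRepresentations.SemiLocalPrincipalUnitsOrbitFactors
import Literature.Algebra.Homology.TwistedCoinvariantsOrbitFactorsFormula
import HarnessLib

/-!
# The orbit-factor isomorphism of `(∏_{w∣v} U¹_w)_{Υ,χ}` on an element supported at ANY place, and on an arbitrary element: the `χ`-weighted transports
# to the base places (de Shalit III §1.3–1.4; Brown III (5.3), (6.2))

Topic `NumberTheory/GaloisRepresentations`; namespace `Literature.NumberTheory.GaloisRepresentations.SemiLocal`, continuing `SemiLocalPrincipalUnitsOrbitFactors.lean`
(★★★ `principalUnitGroupCoinvEquivPiOrbits φ χ`, computed there on elements supported at a BASE place, `_mk_of_mem`) with the generic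
`Algebra/Homology/TwistedCoinvariantsOrbitFactorsFormula` (`quotTwistRelEquivPiOrbitFactors_mk_of_mem_of_smul_eq`, `…_mk_eq_sum`).
* ★★ `principalUnitGroupCoinvEquivPiOrbits_mk_of_mem_of_smul_eq` — for `x ∈ ∏ U¹` supported at the place `w = φ(t)·w(O)` (`x ∈ principalPlaceSummand w`):
  `Φ [x] = single_O (χ(t) • [((φ t)⁻¹ • x)_{w(O)}])` for ANY transporter `t ∈ Υ`;
* `eq_sum_placeLift` (`x = Σ_w x̃_w`, `x̃_w` supported at `w` with the `w`-component of `x`), ★★ `principalUnitGroupCoinvEquivPiOrbits_mk_eq_sum` — for an ARBITRARY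
  `x ∈ ∏ U¹` and any transporters `t_w` (`φ(t_w)·w(O(w)) = w`): `Φ [x] = Σ_w single_{O(w)} (χ(t_w) • [((φ t_w)⁻¹ • x̃_w)_{w(O(w))}])`, and its `O`-component.
Use (cell `bsd-print-cf2`, brick §4(c)/(e)): the class of a GLOBAL (diagonal) unit — an elliptic unit — in each orbit factor is the `χ`-weighted sum over the places of the
orbit of its conjugates read at the base place: the coset sums `Σ_t χ(t)·[(u^{t⁻¹})_𝔓]` of memos BRICK-C-PADIC-g20 F26 / BRICK-C-SHAPIRO-g21 F29, which the local Coleman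
theory evaluates (T17).  Theorems only; no definition, no named fact, no `sorry`, no instance.

## References
* [deShalit1987] E. de Shalit, *Iwasawa theory of elliptic curves with complex multiplication* (1987), III §1.3–1.4.
* [Brown1982CohomologyGroups] K. S. Brown, *Cohomology of Groups* (1982), III §5 Prop. (5.3), (5.8); III §6 (6.2).
* [Rubin1991] K. Rubin, Invent. Math. 103 (1991), §4 p. 36.
-/

noncomputable section

open scoped Classical
open NumberField IsDedekindDomain
open Literature.NumberTheory.Automorphic

namespace Literature.NumberTheory.GaloisRepresentations

namespace SemiLocal

open Literature.Algebra.Homology Literature.Algebra.Homology.InducedModule Literature.Algebra.Homology.CoinducedModule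

variable {F : Type} [Field F] [NumberField F] {E : Type} [Field E] [NumberField E] [Algebra F E]
variable {v : HeightOneSpectrum (𝓞 F)}
variable {Υ : Type} [Group Υ] (φ : Υ →* (E ≃ₐ[F] E)) (χ : Υ →* ℤˣ)

/-- ★★ **On an element supported at ANY place**: for `x ∈ ∏_{w'} U¹_{w'}` supported at `w` (`x ∈ principalPlaceSummand w`), `O` the orbit of `w` and ANY `t ∈ Υ` with
`φ(t)·w(O) = w`: `Φ [x] = single_O (χ(t) • [((φ t)⁻¹ • x)_{w(O)}])` — transport `x` back to the base place `w(O)` by `φ(t)⁻¹` and weight by `χ(t)`.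
[cite: deShalit1987, III §1.3–1.4] [cite: Brown1982CohomologyGroups, III §5 Prop. (5.3); III §6 (6.2)] -/
theorem principalUnitGroupCoinvEquivPiOrbits_mk_of_mem_of_smul_eq (O : PlaceOrbit (v := v) φ) {w : Place F E v} {x : Additive (principalUnitGroup F E v)}
    (hx : x ∈ principalPlaceSummand F E v w) (t : Υ) (ht : φ t • orbitPlace φ O = w) :
    principalUnitGroupCoinvEquivPiOrbits φ χ (Submodule.Quotient.mk x) =
      Pi.single O (((χ t : ℤˣ) : ℤ) • Submodule.Quotient.mk
        (principalUnitGroupProj (orbitPlace φ O) (principalUnitGroupRepr F E v (φ t)⁻¹ x))) :=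
  quotTwistRelEquivPiOrbitFactors_mk_of_mem_of_smul_eq (principalUnitGroupRepr F E v) φ χ _ ker_principalUnitGroupProj_smul
    bijective_pi_principalUnitGroupProj O hx t ht

/-- Every place above `v` is a `φ(Υ)`-translate of the base place of its orbit. [cite: Brown1982CohomologyGroups, III §5 Prop. (5.3)] -/
theorem exists_smul_orbitPlace_eq (w : Place F E v) : ∃ t : Υ, φ t • orbitPlace φ (orbitLabel φ w) = w :=
  exists_smul_orbitBase_eq_self φ w

/-- **`x = Σ_w x̃_w`** with `x̃_w ∈ principalPlaceSummand w` the element supported at `w` with the `w`-component of `x` (the lift of the `w`-th coordinate).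
[cite: Brown1982CohomologyGroups, III §5 Prop. (5.8), (5.9)] -/
theorem eq_sum_placeLift (x : Additive (principalUnitGroup F E v)) :
    x = ∑ w : Place F E v, ((coordSummandEquiv (fun w' : Place F E v => principalUnitGroupProj (F := F) w') bijective_pi_principalUnitGroupProj w).symm
      (principalUnitGroupProj w x) : Additive (principalUnitGroup F E v)) :=
  eq_sum_coordSummandEquiv_symm _ bijective_pi_principalUnitGroupProj x

/-- ★★ **On an arbitrary element**: for ANY transporters `t_w ∈ Υ` (`φ(t_w)·w(O(w)) = w`),
`Φ [x] = Σ_w single_{O(w)} (χ(t_w) • [((φ t_w)⁻¹ • x̃_w)_{w(O(w))}])` — the `O`-component of the class of `x` is the `χ`-weighted sum over the places `w ∈ O` of the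
transports to the base place of the parts of `x` supported at `w` (for a global unit: of its conjugates). [cite: deShalit1987, III §1.3–1.4] [cite: Brown1982CohomologyGroups, III §6 (6.2)] -/
theorem principalUnitGroupCoinvEquivPiOrbits_mk_eq_sum (x : Additive (principalUnitGroup F E v)) (t : Place F E v → Υ)
    (ht : ∀ w, φ (t w) • orbitPlace φ (orbitLabel φ w) = w) :
    principalUnitGroupCoinvEquivPiOrbits φ χ (Submodule.Quotient.mk x) =
      ∑ w : Place F E v, Pi.single (orbitLabel φ w) (((χ (t w) : ℤˣ) : ℤ) • Submodule.Quotient.mk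
        (principalUnitGroupProj (orbitPlace φ (orbitLabel φ w)) (principalUnitGroupRepr F E v (φ (t w))⁻¹
          ((coordSummandEquiv (fun w' : Place F E v => principalUnitGroupProj (F := F) w') bijective_pi_principalUnitGroupProj w).symm
            (principalUnitGroupProj w x) : Additive (principalUnitGroup F E v))))) :=
  quotTwistRelEquivPiOrbitFactors_mk_eq_sum (principalUnitGroupRepr F E v) φ χ _ ker_principalUnitGroupProj_smul bijective_pi_principalUnitGroupProj x t ht

/-- The `O`-component of the previous formula. [cite: deShalit1987, III §1.3–1.4] -/
theorem principalUnitGroupCoinvEquivPiOrbits_mk_apply_eq_sum (x : Additive (principalUnitGroup F E v)) (t : Place F E v → Υ)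
    (ht : ∀ w, φ (t w) • orbitPlace φ (orbitLabel φ w) = w) (O : PlaceOrbit (v := v) φ) :
    principalUnitGroupCoinvEquivPiOrbits φ χ (Submodule.Quotient.mk x) O =
      ∑ w : Place F E v, Pi.single (M := fun O : PlaceOrbit (v := v) φ =>
          Additive (((orbitPlace φ O : Place F E v) : HeightOneSpectrum (𝓞 E)).adicCompletionIntegers E).principalUnitGroup ⧸ localTwistRel φ χ (orbitPlace φ O))
        (orbitLabel φ w) (((χ (t w) : ℤˣ) : ℤ) • Submodule.Quotient.mk
        (principalUnitGroupProj (orbitPlace φ (orbitLabel φ w)) (principalUnitGroupRepr F E v (φ (t w))⁻¹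
          ((coordSummandEquiv (fun w' : Place F E v => principalUnitGroupProj (F := F) w') bijective_pi_principalUnitGroupProj w).symm
            (principalUnitGroupProj w x) : Additive (principalUnitGroup F E v))))) O :=
  quotTwistRelEquivPiOrbitFactors_mk_apply_eq_sum (principalUnitGroupRepr F E v) φ χ _ ker_principalUnitGroupProj_smul bijective_pi_principalUnitGroupProj x t ht O

end SemiLocal

end Literature.NumberTheory.GaloisRepresentations

end
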